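import Summits.MatrixMultiplication.MatrixMultiplication.Theorems.FarEdgeDescentNearVertex
import Literature.Computability.AlgebraicComplexity.RectangularExponentSymmetry
import HarnessLib

/-!
# Route `FarEdgeDescent` — the dichotomy lens at the NEAR vertex, II: the exact cut `ω = 2 ⟺ NearTame ∧ NearSmooth`, and why the walls

Support module (def-free), continuation of `FarEdgeDescentNearVertex` (Part I: global convexity of
`f(x) = ω(1,x,1)`, one-sided derivatives at `α = dualExponentAlpha ℂ`, and the exhaustion
`ω(ℂ) > 2 ⟺ CORNER (N2) ∨ TANGENTIAL (N3)` departure at `α`).  Items served: asides `SmoothProfile`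
(stmt-MatrixMultiplication-27850), `TameProfile` (stmt-MatrixMultiplication-31917), crux `FiniteSaturation`
(stmt-MatrixMultiplication-23739); the cut of record `ω(ℂ) = 2 ⟺ FiniteSaturation ∧ AnchoredLogConvexity` and
`closes` are unchanged.

* §3 ★ THE EXACT NEAR-VERTEX REGULARITY CUT `ω(ℂ) = 2 ⟺ NearTame ∧ NearSmooth` (`node_near_iff`, deciding theorem
  `closes_near`), both pieces NECESSARY (`nearTame_of_mm`, `nearSmooth_of_mm`) and each killing exactly one atom:
  NearTame := «`f|[0,1]` is a maximum of finitely many affine functions» (special; kills N3,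
  `not_tangential_of_nearTame`: a piece touching at `α` has slope `≤ f'(α) = 0`, so just right of `α` no piece
  reaches `f > 2`), NearSmooth := «`f` differentiable on `[0,1)`» (generic; kills N2, `not_corner_of_nearSmooth`).
  The atomic form `ω = 2 ⟺ ¬N2 ∧ ¬N3` is recorded honestly as a case split (`mm_iff_no_near_atom`); the two
  dichotomy cuts of the lineage side by side: `far_and_near_cuts`.
* §4 WHY THE WALLS.  The 2D excess `ω(1,x,y) − x − y` vanishes on the far quadrant `x, y ≥ 1/α`
  (`farQuadrant_saturated_of_le`: a saturated DIAGONAL shape `ω(1,x,x) = 2x ⟺ 1/x ≤ α`, `diag_saturated_iff`,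
  by homogeneity, then padding by subadditivity — Lotti–Romani §1); every INTERIOR ray from the square shape
  `(1,1)` saturates in finite time (`ray_eventually_saturated`), and the diagonal analogue of a one-step descent
  law is LITERALLY `ω = 2` (`diagonalHalving_iff_mm`, a costume certificate) — whereas on the WALL `y = 1`
  eventual saturation is exactly the open special crux `FiniteSaturation` (`wall_eventually_saturated_iff`).
  The statements of §4 that need `α > 0` take it as a hypothesis (discharged by `alpha_pos_of_vxxz` of Part I or
  by Coppersmith's theorem).

Placement [cite: LottiRomani1983, §1 (p. 173), Prop. 4.1] [cite: LeGall2012, §1] [cite: HuangPan1998, §2 (2.4), (2.8)]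
[cite: VassilevskaWilliamsXuXuZhou2024, §1] [cite: Coppersmith1982, Theorem].
Written by the decomp-mm lens-2 planner seat (gen 23); imports only BUILT modules; no new definitions.
-/

set_option linter.dupNamespace false

noncomputable section

namespace Summit.MatrixMultiplication.MatrixMultiplication.Theorems.FarEdgeDescentNearEdgeCut

open Literature.Computability.AlgebraicComplexity
open Summit.MatrixMultiplication.MatrixMultiplication.Theses.FarEdgeDescent
open Summit.MatrixMultiplication.MatrixMultiplication.Theorems.FarEdgeDescentChord
open Summit.MatrixMultiplication.MatrixMultiplication.Theorems.FarEdgeDescentNearVertex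
open Filter Topology Set

/-! ## §3 ★ The exact near-vertex regularity cut `ω(ℂ) = 2 ⟺ NearTame ∧ NearSmooth` -/

/-- NEC (special piece): `ω = 2 → NearTame` — on `[0,1]` the profile is the single affine piece `2`. -/
theorem nearTame_of_mm (hS : _root_.MatrixMultiplication) :
    ∃ N : ℕ, ∃ c d : Fin (N + 1) → ℝ, ∀ m : ℝ, 0 ≤ m → m ≤ 1 →
      IsGreatest (Set.range fun i : Fin (N + 1) => c i * m + d i) (omegaRect ℂ 1 m 1) := by
  have hα : dualExponentAlpha ℂ = 1 := (dualExponentAlpha_eq_one_iff ℂ).2 (_root_.MatrixMultiplication_iff.1 hS)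
  refine ⟨0, fun _ => 0, fun _ => 2, fun m _ hm1 => ?_⟩
  have hm : omegaRect ℂ 1 m 1 = 2 := profile_eq_two_of_le_alpha (by rw [hα]; exact hm1)
  refine ⟨⟨0, by simp [hm]⟩, ?_⟩
  rintro _ ⟨i, rfl⟩
  simp [hm]

/-- NEC (generic piece): `ω = 2 → NearSmooth` — `f ≡ 2` on `(-∞, 1)`, so `f` is differentiable on `[0,1)`. -/
theorem nearSmooth_of_mm (hS : _root_.MatrixMultiplication) :
    ∀ x : ℝ, 0 ≤ x → x < 1 → DifferentiableAt ℝ (fun y : ℝ => omegaRect ℂ 1 y 1) x := by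
  intro x _ hx1
  have hα : dualExponentAlpha ℂ = 1 := (dualExponentAlpha_eq_one_iff ℂ).2 (_root_.MatrixMultiplication_iff.1 hS)
  have h : HasDerivAt (fun y : ℝ => omegaRect ℂ 1 y 1) 0 x := by
    refine (hasDerivAt_const x (2 : ℝ)).congr_of_eventuallyEq ?_
    filter_upwards [Iio_mem_nhds hx1] with y hy
    exact profile_eq_two_of_le_alpha (by rw [hα]; exact le_of_lt hy)
  exact h.differentiableAt

/-- ★ **NearTame kills the tangential atom.**  If `f|[0,1]` is a finite maximum of affine pieces and `α < 1`, then
`f` is NOT differentiable at `α`: a piece touching at `α` has slope `≤ f'(α) = 0`, so just right of `α` no piece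
reaches `f > 2` — contradiction.  (Finiteness is used through `Filter.eventually_all`.) -/
theorem not_tangential_of_nearTame
    (hT : ∃ N : ℕ, ∃ c d : Fin (N + 1) → ℝ, ∀ m : ℝ, 0 ≤ m → m ≤ 1 →
      IsGreatest (Set.range fun i : Fin (N + 1) => c i * m + d i) (omegaRect ℂ 1 m 1)) :
    ¬ (dualExponentAlpha ℂ < 1 ∧
        DifferentiableAt ℝ (fun y : ℝ => omegaRect ℂ 1 y 1) (dualExponentAlpha ℂ)) := by
  rintro ⟨hα1, hd⟩
  obtain ⟨N, c, d, h⟩ := hT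
  have hα0 : 0 ≤ dualExponentAlpha ℂ := dualExponentAlpha_nonneg ℂ
  have hle : ∀ i, ∀ m : ℝ, 0 ≤ m → m ≤ 1 → c i * m + d i ≤ omegaRect ℂ 1 m 1 :=
    fun i m hm0 hm1 => (h m hm0 hm1).2 ⟨i, rfl⟩
  have hleα : ∀ i, c i * dualExponentAlpha ℂ + d i ≤ 2 := fun i => by
    have h1 := hle i (dualExponentAlpha ℂ) hα0 hα1.le
    rwa [omegaRect_dualExponentAlpha] at h1
  -- a piece touching the profile at `α` has slope `≤ 0`
  have htouch : ∀ i, c i * dualExponentAlpha ℂ + d i = 2 → c i ≤ 0 := by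
    intro i hi
    refine slope_nonpos_of_support hd ?_
    filter_upwards [Ioo_mem_nhdsGT hα1] with m hm
    have h1 := hle i m (by linarith [hm.1]) hm.2.le
    have e : 2 + c i * (m - dualExponentAlpha ℂ) = c i * m + d i := by linear_combination -hi
    linarith
  -- just right of `α`, no piece reaches the profile
  have hev : ∀ i, ∀ᶠ m in 𝓝[>] (dualExponentAlpha ℂ), c i * m + d i < omegaRect ℂ 1 m 1 := by
    intro i
    rcases (hleα i).lt_or_eq with hlt | heq
    · have ht : Tendsto (fun m : ℝ => c i * m + d i) (𝓝[>] (dualExponentAlpha ℂ))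
          (𝓝 (c i * dualExponentAlpha ℂ + d i)) :=
        (((continuous_const.mul continuous_id).add continuous_const).tendsto (dualExponentAlpha ℂ)).mono_left
          nhdsWithin_le_nhds
      filter_upwards [ht.eventually_lt_const hlt] with m hm
      exact lt_of_lt_of_le hm (two_le_omegaRect_one_mid_one ℂ m)
    · have hc := htouch i heq
      filter_upwards [self_mem_nhdsWithin] with m hm
      rw [mem_Ioi] at hm
      have h2 : 2 < omegaRect ℂ 1 m 1 := two_lt_profile_of_alpha_lt hm
      nlinarith [mul_nonpos_iff.2 (Or.inr ⟨hc, (sub_pos.2 hm).le⟩)]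
  have hev' : ∀ᶠ m in 𝓝[>] (dualExponentAlpha ℂ),
      (∀ i, c i * m + d i < omegaRect ℂ 1 m 1) ∧ m ∈ Ioo (dualExponentAlpha ℂ) 1 :=
    (eventually_all.2 hev).and (Ioo_mem_nhdsGT hα1)
  obtain ⟨m, hm, hmI⟩ := hev'.exists
  obtain ⟨i, hi⟩ := (h m (by linarith [hmI.1]) hmI.2.le).1
  exact absurd hi (ne_of_lt (hm i))

/-- ★ **NearSmooth kills the corner atom** (`0 ≤ α < 1` lies in the differentiability range `[0,1)`). -/
theorem not_corner_of_nearSmooth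
    (hD : ∀ x : ℝ, 0 ≤ x → x < 1 → DifferentiableAt ℝ (fun y : ℝ => omegaRect ℂ 1 y 1) x) :
    ¬ (dualExponentAlpha ℂ < 1 ∧ ∃ s : ℝ, 0 < s ∧
        ∀ x : ℝ, 2 + s * (x - dualExponentAlpha ℂ) ≤ omegaRect ℂ 1 x 1) := by
  rintro ⟨hα1, s, hs, hsup⟩
  have hd := hD (dualExponentAlpha ℂ) (dualExponentAlpha_nonneg ℂ) hα1
  have h := slope_nonpos_of_support hd (s := s) (Eventually.of_forall fun m => hsup m)
  linarith

/-- ★ **Deciding theorem of the near-vertex cut**: `NearTame → NearSmooth → ω(ℂ) = 2`. -/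
theorem closes_near
    (hT : ∃ N : ℕ, ∃ c d : Fin (N + 1) → ℝ, ∀ m : ℝ, 0 ≤ m → m ≤ 1 →
      IsGreatest (Set.range fun i : Fin (N + 1) => c i * m + d i) (omegaRect ℂ 1 m 1))
    (hD : ∀ x : ℝ, 0 ≤ x → x < 1 → DifferentiableAt ℝ (fun y : ℝ => omegaRect ℂ 1 y 1) x) :
    _root_.MatrixMultiplication := by
  by_contra hS
  rcases not_mm_iff_corner_or_tangential.1 hS with hC | hTan
  · exact not_corner_of_nearSmooth hD hC
  · exact not_tangential_of_nearTame hT hTan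

/-- ★ **THE EXACT NEAR-VERTEX REGULARITY CUT** `ω(ℂ) = 2 ⟺ NearTame ∧ NearSmooth`. -/
theorem node_near_iff :
    _root_.MatrixMultiplication ↔
      (∃ N : ℕ, ∃ c d : Fin (N + 1) → ℝ, ∀ m : ℝ, 0 ≤ m → m ≤ 1 →
          IsGreatest (Set.range fun i : Fin (N + 1) => c i * m + d i) (omegaRect ℂ 1 m 1)) ∧
      (∀ x : ℝ, 0 ≤ x → x < 1 → DifferentiableAt ℝ (fun y : ℝ => omegaRect ℂ 1 y 1) x) :=
  ⟨fun h => ⟨nearTame_of_mm h, nearSmooth_of_mm h⟩, fun h => closes_near h.1 h.2⟩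

/-- HONESTY — the atomic form `ω(ℂ) = 2 ⟺ ¬N2 ∧ ¬N3` is a case split (each conjunct is the other's residual),
recorded as the common refinement, not as a node. -/
theorem mm_iff_no_near_atom :
    _root_.MatrixMultiplication ↔
      (¬ (dualExponentAlpha ℂ < 1 ∧ ∃ s : ℝ, 0 < s ∧
          ∀ x : ℝ, 2 + s * (x - dualExponentAlpha ℂ) ≤ omegaRect ℂ 1 x 1)) ∧
      ¬ (dualExponentAlpha ℂ < 1 ∧
          DifferentiableAt ℝ (fun y : ℝ => omegaRect ℂ 1 y 1) (dualExponentAlpha ℂ)) := by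
  constructor
  · intro h
    exact ⟨fun hC => not_mm_of_corner hC h, fun hT => not_mm_of_tangential hT h⟩
  · rintro ⟨hC, hT⟩
    by_contra hS
    rcases not_mm_iff_corner_or_tangential.1 hS with h | h
    · exact hC h
    · exact hT h

/-- The two dichotomy cuts of the lineage side by side: FAR `ω = 2 ⟺ FiniteSaturation ∧ AnchoredLogConvexity`
(record) and NEAR `ω = 2 ⟺ NearTame ∧ NearSmooth` (this file). -/
theorem far_and_near_cuts :
    (_root_.MatrixMultiplication ↔ FiniteSaturation ∧ AnchoredLogConvexity) ∧
    (_root_.MatrixMultiplication ↔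
      (∃ N : ℕ, ∃ c d : Fin (N + 1) → ℝ, ∀ m : ℝ, 0 ≤ m → m ≤ 1 →
          IsGreatest (Set.range fun i : Fin (N + 1) => c i * m + d i) (omegaRect ℂ 1 m 1)) ∧
      (∀ x : ℝ, 0 ≤ x → x < 1 → DifferentiableAt ℝ (fun y : ℝ => omegaRect ℂ 1 y 1) x)) :=
  ⟨node_iff, node_near_iff⟩

/-! ## §4 Why the walls: the far quadrant is saturated, interior rays saturate, diagonal laws are costumes -/

/-- The diagonal shapes by homogeneity: `ω(1, x, x) = x · ω(1, 1/x, 1)` for `x > 0` (Lotti–Romani §1). -/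
theorem diag_eq {x : ℝ} (hx : 0 < x) : omegaRect ℂ 1 x x = x * omegaRect ℂ 1 x⁻¹ 1 := by
  have h := LottiRomani1983_homogeneous ℂ (ν := x) (x := x⁻¹) (y := 1) (z := 1) hx.le
    (inv_nonneg.2 hx.le) zero_le_one zero_le_one
  rw [mul_inv_cancel₀ hx.ne', mul_one, omegaRect_swap₁₂ ℂ x⁻¹ 1 1] at h
  exact h

/-- ★ **Diagonal saturation criterion**: `ω(1, x, x) = 2x ⟺ 1/x ≤ α` (`x > 0`). -/
theorem diag_saturated_iff {x : ℝ} (hx : 0 < x) :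
    omegaRect ℂ 1 x x = 2 * x ↔ x⁻¹ ≤ dualExponentAlpha ℂ := by
  rw [diag_eq hx, ← omegaRect_eq_two_iff_le_dualExponentAlpha ℂ x⁻¹]
  constructor
  · intro h
    exact mul_left_cancel₀ hx.ne' (h.trans (mul_comm 2 x))
  · intro h
    rw [h, mul_comm]

/-- ★ **Far-quadrant saturation**: `ω(1, x, y) = x + y` whenever `0 < x ≤ y` and `1/x ≤ α`
(a saturated diagonal shape padded in the last slot: subadditivity with `ω(0, 0, y − x) = y − x`). -/
theorem farQuadrant_saturated {x y : ℝ} (hx : 0 < x) (hxa : x⁻¹ ≤ dualExponentAlpha ℂ) (hxy : x ≤ y) :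
    omegaRect ℂ 1 x y = x + y := by
  refine le_antisymm ?_ (add_le_omegaRect₂₃ ℂ 1 x y)
  have hd : omegaRect ℂ 1 x x = 2 * x := (diag_saturated_iff hx).2 hxa
  have hsub := LottiRomani1983_subadditive ℂ 1 x x 0 0 (y - x)
  rw [add_zero, add_zero, add_sub_cancel, hd,
    omegaRect_eq_add_of_nonpos₁ ℂ le_rfl le_rfl (sub_nonneg.2 hxy), zero_add] at hsub
  linarith

/-- Far-quadrant saturation, the other half (`0 < y ≤ x`, `1/y ≤ α`), by the slot symmetry `ω(1,x,y) = ω(1,y,x)`. -/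
theorem farQuadrant_saturated' {x y : ℝ} (hy : 0 < y) (hya : y⁻¹ ≤ dualExponentAlpha ℂ) (hyx : y ≤ x) :
    omegaRect ℂ 1 x y = x + y := by
  rw [omegaRect_swap₂₃, farQuadrant_saturated hy hya hyx, add_comm]

/-- ★ **The far quadrant `[1/α, ∞)²` is saturated** (for `α > 0`): `ω(1, x, y) = x + y` for `x, y ≥ 1/α`. -/
theorem farQuadrant_saturated_of_le (hα : 0 < dualExponentAlpha ℂ) {x y : ℝ}
    (hx : (dualExponentAlpha ℂ)⁻¹ ≤ x) (hy : (dualExponentAlpha ℂ)⁻¹ ≤ y) :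
    omegaRect ℂ 1 x y = x + y := by
  have hx0 : 0 < x := lt_of_lt_of_le (inv_pos.2 hα) hx
  have hy0 : 0 < y := lt_of_lt_of_le (inv_pos.2 hα) hy
  rcases le_total x y with hxy | hyx
  · exact farQuadrant_saturated hx0 (inv_le_of_inv_le₀ hα hx) hxy
  · exact farQuadrant_saturated' hy0 (inv_le_of_inv_le₀ hα hy) hyx

/-- ★ **Every INTERIOR ray from the square shape saturates in finite time** (`α > 0`): along
`t ↦ (1, 1 + t a, 1 + t b)` with `a, b > 0` the 2D excess `ω(1,x,y) − x − y` vanishes for all large `t`.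
So on interior rays the «special piece» (a finite saturation) is a THEOREM and any one-step descent law there is
equivalent to `ω = 2` (cf. `diagonalHalving_iff_mm`); only the WALL rays (`b = 0`: the far edge) are non-costume. -/
theorem ray_eventually_saturated (hα : 0 < dualExponentAlpha ℂ) {a b : ℝ} (ha : 0 < a) (hb : 0 < b) :
    ∃ T : ℝ, ∀ t : ℝ, T ≤ t →
      omegaRect ℂ 1 (1 + t * a) (1 + t * b) = (1 + t * a) + (1 + t * b) := by
  refine ⟨(dualExponentAlpha ℂ)⁻¹ / a + (dualExponentAlpha ℂ)⁻¹ / b, fun t ht => ?_⟩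
  have hi : 0 < (dualExponentAlpha ℂ)⁻¹ := inv_pos.2 hα
  have hta : (dualExponentAlpha ℂ)⁻¹ / a ≤ t := by
    have := div_pos hi hb
    linarith
  have htb : (dualExponentAlpha ℂ)⁻¹ / b ≤ t := by
    have := div_pos hi ha
    linarith
  have hxa : (dualExponentAlpha ℂ)⁻¹ ≤ 1 + t * a := by
    have h1 : (dualExponentAlpha ℂ)⁻¹ = (dualExponentAlpha ℂ)⁻¹ / a * a := by field_simp
    have h2 : (dualExponentAlpha ℂ)⁻¹ / a * a ≤ t * a := mul_le_mul_of_nonneg_right hta ha.le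
    linarith
  have hyb : (dualExponentAlpha ℂ)⁻¹ ≤ 1 + t * b := by
    have h1 : (dualExponentAlpha ℂ)⁻¹ = (dualExponentAlpha ℂ)⁻¹ / b * b := by field_simp
    have h2 : (dualExponentAlpha ℂ)⁻¹ / b * b ≤ t * b := mul_le_mul_of_nonneg_right htb hb.le
    linarith
  exact farQuadrant_saturated_of_le hα hxa hyb

/-- … whereas on the WALL ray `t ↦ (1, 1 + t, 1)` eventual saturation is EXACTLY the open special crux
`FiniteSaturation` (`e` non-increasing: one saturated shape saturates all larger ones). -/
theorem wall_eventually_saturated_iff :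
    (∃ T : ℝ, ∀ t : ℝ, T ≤ t → omegaRect ℂ 1 (1 + t) 1 = (1 + t) + 1) ↔ FiniteSaturation := by
  rw [finiteSaturation_iff_realSaturation]
  constructor
  · rintro ⟨T, hT⟩
    refine ⟨1 + max T 1, by linarith [le_max_right T 1], ?_⟩
    exact hT (max T 1) (le_max_left T 1)
  · rintro ⟨k, hk, hs⟩
    refine ⟨k - 1, fun t ht => ?_⟩
    have h := FarEdgeDescentContactTrichotomy.saturated_of_le hs (y := 1 + t) (by linarith)
    rw [h]

/-- ★ **COSTUME CERTIFICATE for diagonal descent laws** (`α > 0`): the diagonal analogue of a one-step halving law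
— «saturation at the diagonal shape `2m − 1` descends to the diagonal shape `m`» — is LITERALLY EQUIVALENT to
`ω(ℂ) = 2` (one step from the saturated shape `1/α` lands at `(1/α + 1)/2 < 1/α`, forcing `α = 1`).  The same law on
the wall is a genuine residual of `FiniteSaturation`; this is why the record's special piece lives on the wall. -/
theorem diagonalHalving_iff_mm (hα : 0 < dualExponentAlpha ℂ) :
    (∀ m : ℝ, 1 < m → omegaRect ℂ 1 (2 * m - 1) (2 * m - 1) = 2 * (2 * m - 1) →
        omegaRect ℂ 1 m m = 2 * m) ↔ _root_.MatrixMultiplication := by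
  rw [_root_.MatrixMultiplication_iff, ← dualExponentAlpha_eq_one_iff ℂ]
  constructor
  · intro h
    by_contra hne
    have hα1 : dualExponentAlpha ℂ < 1 := lt_of_le_of_ne (dualExponentAlpha_le_one ℂ) hne
    have hi1 : 1 < (dualExponentAlpha ℂ)⁻¹ := one_lt_inv_iff₀.2 ⟨hα, hα1⟩
    -- the saturated diagonal shape `1/α` written as `2m − 1`
    have hm1 : 1 < ((dualExponentAlpha ℂ)⁻¹ + 1) / 2 := by linarith
    have hm0 : 0 < ((dualExponentAlpha ℂ)⁻¹ + 1) / 2 := by linarith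
    have e : 2 * (((dualExponentAlpha ℂ)⁻¹ + 1) / 2) - 1 = (dualExponentAlpha ℂ)⁻¹ := by ring
    have hsat : omegaRect ℂ 1 (2 * (((dualExponentAlpha ℂ)⁻¹ + 1) / 2) - 1)
        (2 * (((dualExponentAlpha ℂ)⁻¹ + 1) / 2) - 1) = 2 * (2 * (((dualExponentAlpha ℂ)⁻¹ + 1) / 2) - 1) := by
      rw [e]
      exact (diag_saturated_iff (inv_pos.2 hα)).2 (by rw [inv_inv])
    have hnext := (diag_saturated_iff hm0).1 (h _ hm1 hsat)
    -- `(2 / (1/α + 1)) ≤ α` forces `α ≥ 1`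
    rw [inv_div, div_le_iff₀ (by linarith)] at hnext
    have hαα : dualExponentAlpha ℂ * (dualExponentAlpha ℂ)⁻¹ = 1 := mul_inv_cancel₀ hα.ne'
    nlinarith
  · intro hα1 m hm _
    exact (diag_saturated_iff (by linarith)).2 (by rw [hα1]; exact inv_le_one_of_one_le₀ hm.le)

end Summit.MatrixMultiplication.MatrixMultiplication.Theorems.FarEdgeDescentNearEdgeCut

end
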